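import Mathlib.Analysis.SpecialFunctions.ImproperIntegrals
import Mathlib.MeasureTheory.Integral.IntegralEqImproper
import Mathlib.Analysis.Complex.RealDeriv
import Mathlib.Analysis.SpecialFunctions.ExpDeriv
import Literature.Analysis.Fourier.HolomorphicParamIntegral
import HarnessLib

/-!
# The Laplace transform on the half-line of an exponentially bounded continuous function

Topic `Literature/Analysis/Complex` (next to `LaplaceDecaySupport.lean`, which treats `L¹` densities of bounded
support). Everything here is PROVED; standard material, cited by theorem number from J. L. Schiff, *The Laplace
Transform: Theory and Applications* (Springer UTM 1999) [Schiff1999] (also Widder, *The Laplace Transform*, Ch. II).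

For `g : ℝ → ℂ` continuous with `‖g t‖ ≤ G e^{γt}` on `t ≥ 0` (`HalfLineExpBound g G γ`) and
`𝓛g(s) = ∫_{(0,∞)} e^{−st} g(t) dt` (`laplaceC g s`):
* `HalfLineExpBound.integrableOn` / `norm_laplaceC_le` — absolute convergence and `‖𝓛g(s)‖ ≤ G/(Re s − γ)` on `Re s > γ`;
* `HalfLineExpBound.differentiableOn_laplaceC` — `𝓛g` is holomorphic on the open half-plane `Re s > γ`
  (dominated holomorphic families, `Literature.Analysis.Fourier.differentiableOn_integral_of_dominated_holomorphic`);
* `laplaceC_add` / `laplaceC_sub` / `laplaceC_congr` — linearity and dependence on `g|_{(0,∞)}` only;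
* `HalfLineExpBound.mul_laplaceC_eq` — ONE INTEGRATION BY PARTS: for `k ∈ C¹` on `(0,∞)` with `k, k'` both
  `O(e^{−μt})`, `s·𝓛k(s) = k(0) + 𝓛k'(s)` on `Re s > −μ`, whence the uniform decay
  `‖𝓛k(s)‖ ≤ (‖k 0‖ + K'/(μ − β))/‖s‖` on `Re s ≥ −β > −μ` (`norm_laplaceC_le_div_norm`), the input for shifting
  Bromwich contours (`LaplaceHalfLineInversion.lean`, `Convolution/RenewalResolventPole.lean`).

Design: `laplaceC` is the plain Bochner set integral (value `0` where divergent); the kernel is written `cexp (-(s * t))`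
exactly as in the tree's `C0Semigroup.laplaceResolventFun`, so that `𝓛(θ⟪h, S(·)f⟫) = θ⟪h, R(·)f⟫` is a one-line
consequence of `ContinuousLinearMap.integral_comp_comm`. NOT here: inversion, convolution theorem (next file), and any
statement about operators or about a specific model.
-/

noncomputable section

open _root_.Complex _root_.MeasureTheory _root_.Set _root_.Filter _root_.Real
open scoped _root_.Topology

namespace Literature.Analysis.Complex

/-! ### Definitions -/

/-- The complex Laplace transform on the half-line, `𝓛g(s) = ∫_{(0,∞)} e^{−st} g(t) dt` (Bochner set integral;
`0` where the integral diverges). [cite: Schiff1999, §1.1 eq. (1.1)] -/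
def laplaceC (g : ℝ → ℂ) (s : ℂ) : ℂ := ∫ t in Ioi (0 : ℝ), cexp (-(s * t)) * g t

/-- A continuous function with an exponential bound on the half-line: `‖g t‖ ≤ G e^{γt}` for `t ≥ 0`
(the values of `g` on `t < 0` are irrelevant to everything in this file) — «continuous of exponential order `γ`»
with the constant made explicit. [cite: Schiff1999, Definition 1.10] -/
structure HalfLineExpBound (g : ℝ → ℂ) (G γ : ℝ) : Prop where
  continuous : Continuous g
  bound : ∀ t : ℝ, 0 ≤ t → ‖g t‖ ≤ G * Real.exp (γ * t)

/-! ### The kernel -/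

/-- `‖e^{−st}‖ = e^{−(Re s) t}` for real `t` (also in the tree as
`Literature.MathematicalPhysics.QuantumFieldTheory.Balaban1983to89.T4ComplexDilation.norm_cexp_neg_mul_ofReal`, not imported
here to keep this file light). [folklore] -/
private theorem norm_cexp_neg_mul_ofReal' (s : ℂ) (t : ℝ) : ‖cexp (-(s * t))‖ = Real.exp (-(s.re * t)) := by
  rw [Complex.norm_exp]
  congr 1
  simp [Complex.mul_re]

/-- The kernel `t ↦ e^{−st}` is continuous. [cite: Schiff1999, Theorem 1.11 (proof)] -/
theorem continuous_cexp_neg_mul (s : ℂ) : Continuous fun t : ℝ => cexp (-(s * t)) := by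
  fun_prop

/-- The kernel has derivative `−s e^{−st}` in the real variable `t`. [cite: Schiff1999, Theorem 2.7 (proof)] -/
theorem hasDerivAt_cexp_neg_mul (s : ℂ) (t : ℝ) :
    HasDerivAt (fun u : ℝ => cexp (-(s * u))) (-s * cexp (-(s * t))) t := by
  have h1 : HasDerivAt (fun u : ℝ => (u : ℂ)) 1 t := by
    simpa using (hasDerivAt_id t).ofReal_comp
  have h2 : HasDerivAt (fun u : ℝ => -(s * (u : ℂ))) (-s) t := by
    have h := h1.const_mul (-s)
    simp only [mul_one] at h
    exact h.congr_of_eventuallyEq (Eventually.of_forall fun u => by ring)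
  have h3 := h2.cexp
  exact h3.congr_deriv (by ring)

namespace HalfLineExpBound

variable {g : ℝ → ℂ} {G γ : ℝ}

/-- The constant in an exponential bound is non-negative. [cite: Schiff1999, Definition 1.10] -/
theorem nonneg (h : HalfLineExpBound g G γ) : 0 ≤ G := by
  have := h.bound 0 le_rfl
  rw [mul_zero, Real.exp_zero, mul_one] at this
  exact (norm_nonneg _).trans this

/-- Weakening the rate: `γ ≤ γ'`. [cite: Schiff1999, Definition 1.10] -/
theorem mono (h : HalfLineExpBound g G γ) {γ' : ℝ} (hγ : γ ≤ γ') : HalfLineExpBound g G γ' :=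
  ⟨h.continuous, fun t ht => (h.bound t ht).trans (by
    have := h.nonneg
    gcongr)⟩

/-- Sums of functions of exponential order. [cite: Schiff1999, Definition 1.10 / §1.6 (1.11)] -/
theorem add {g₁ g₂ : ℝ → ℂ} {G₁ G₂ : ℝ} (h₁ : HalfLineExpBound g₁ G₁ γ) (h₂ : HalfLineExpBound g₂ G₂ γ) :
    HalfLineExpBound (fun t => g₁ t + g₂ t) (G₁ + G₂) γ :=
  ⟨h₁.continuous.add h₂.continuous, fun t ht =>
    (norm_add_le _ _).trans (by rw [add_mul]; exact add_le_add (h₁.bound t ht) (h₂.bound t ht))⟩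

/-- Differences of functions of exponential order. [cite: Schiff1999, Definition 1.10 / §1.6 (1.11)] -/
theorem sub {g₁ g₂ : ℝ → ℂ} {G₁ G₂ : ℝ} (h₁ : HalfLineExpBound g₁ G₁ γ) (h₂ : HalfLineExpBound g₂ G₂ γ) :
    HalfLineExpBound (fun t => g₁ t - g₂ t) (G₁ + G₂) γ :=
  ⟨h₁.continuous.sub h₂.continuous, fun t ht =>
    (norm_sub_le _ _).trans (by rw [add_mul]; exact add_le_add (h₁.bound t ht) (h₂.bound t ht))⟩

/-- Scalar multiples of functions of exponential order. [cite: Schiff1999, Definition 1.10] -/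
theorem const_mul (h : HalfLineExpBound g G γ) (c : ℂ) :
    HalfLineExpBound (fun t => c * g t) (‖c‖ * G) γ :=
  ⟨continuous_const.mul h.continuous, fun t ht => by
    rw [norm_mul, mul_assoc]
    exact mul_le_mul_of_nonneg_left (h.bound t ht) (norm_nonneg _)⟩

/-- Pointwise bound on the Laplace integrand: `‖e^{−st} g(t)‖ ≤ G e^{(γ − Re s)t}` for `t ≥ 0`.
[cite: Schiff1999, Theorem 1.11 (proof)] -/
theorem norm_integrand_le (h : HalfLineExpBound g G γ) (s : ℂ) {t : ℝ} (ht : 0 ≤ t) :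
    ‖cexp (-(s * t)) * g t‖ ≤ G * Real.exp ((γ - s.re) * t) := by
  rw [norm_mul, norm_cexp_neg_mul_ofReal']
  calc Real.exp (-(s.re * t)) * ‖g t‖ ≤ Real.exp (-(s.re * t)) * (G * Real.exp (γ * t)) :=
        mul_le_mul_of_nonneg_left (h.bound t ht) (Real.exp_pos _).le
    _ = G * Real.exp ((γ - s.re) * t) := by
        rw [show (γ - s.re) * t = -(s.re * t) + γ * t by ring, Real.exp_add]; ring

/-- **Absolute convergence** on `Re s > γ`: the Laplace integrand is integrable on `(0,∞)`.
[cite: Schiff1999, Theorem 1.11] -/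
theorem integrableOn (h : HalfLineExpBound g G γ) {s : ℂ} (hs : γ < s.re) :
    IntegrableOn (fun t : ℝ => cexp (-(s * t)) * g t) (Ioi 0) := by
  have hdom : IntegrableOn (fun t : ℝ => G * Real.exp ((γ - s.re) * t)) (Ioi 0) :=
    (integrableOn_exp_mul_Ioi (by linarith) 0).const_mul G
  refine Integrable.mono' hdom (((continuous_cexp_neg_mul s).mul h.continuous).aestronglyMeasurable) ?_
  exact (ae_restrict_iff' measurableSet_Ioi).2 (Eventually.of_forall fun t ht => h.norm_integrand_le s (le_of_lt ht))

/-- **The half-plane bound** `‖𝓛g(s)‖ ≤ G/(Re s − γ)` for `Re s > γ`. [cite: Schiff1999, Theorem 1.11 (proof)] -/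
theorem norm_laplaceC_le (h : HalfLineExpBound g G γ) {s : ℂ} (hs : γ < s.re) :
    ‖laplaceC g s‖ ≤ G / (s.re - γ) := by
  have hdom : IntegrableOn (fun t : ℝ => G * Real.exp ((γ - s.re) * t)) (Ioi 0) :=
    (integrableOn_exp_mul_Ioi (by linarith) 0).const_mul G
  calc ‖laplaceC g s‖ ≤ ∫ t in Ioi (0 : ℝ), ‖cexp (-(s * t)) * g t‖ := norm_integral_le_integral_norm _
    _ ≤ ∫ t in Ioi (0 : ℝ), G * Real.exp ((γ - s.re) * t) :=
        setIntegral_mono_on (h.integrableOn hs).norm hdom measurableSet_Ioi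
          fun t ht => h.norm_integrand_le s (le_of_lt ht)
    _ = G / (s.re - γ) := by
        rw [MeasureTheory.integral_const_mul, integral_exp_mul_Ioi (by linarith) 0, mul_zero, Real.exp_zero]
        have hne : γ - s.re ≠ 0 := by linarith
        have hne2 : s.re - γ ≠ 0 := by linarith
        rw [mul_div_assoc', div_eq_div_iff hne hne2]
        ring

/-- **Holomorphy**: `𝓛g` is complex differentiable on the open half-plane `{Re s > γ}`. [cite: Schiff1999, Theorem 3.1] -/
theorem differentiableOn_laplaceC (h : HalfLineExpBound g G γ) :
    DifferentiableOn ℂ (laplaceC g) {s : ℂ | γ < s.re} := by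
  -- on every smaller half-plane `Re s > γ'`, `γ' > γ`, the family is uniformly dominated
  have hU : ∀ γ' : ℝ, γ < γ' → DifferentiableOn ℂ (laplaceC g) {s : ℂ | γ' < s.re} := by
    intro γ' hγ'
    have hopen : IsOpen {s : ℂ | γ' < s.re} := isOpen_lt continuous_const Complex.continuous_re
    have key := Literature.Analysis.Fourier.differentiableOn_integral_of_dominated_holomorphic hopen
      (μ := volume.restrict (Ioi (0 : ℝ))) (K := fun (s : ℂ) (t : ℝ) => cexp (-(s * t)) * g t)
      (B := fun t => G * Real.exp ((γ - γ') * t))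
      (fun s _ => ((continuous_cexp_neg_mul s).mul h.continuous).aestronglyMeasurable)
      (Eventually.of_forall fun t => ?_) ?_ ((integrableOn_exp_mul_Ioi (by linarith) 0).const_mul G)
    · exact key
    · apply Differentiable.differentiableOn
      fun_prop
    · refine (ae_restrict_iff' measurableSet_Ioi).2 (Eventually.of_forall fun t (ht : 0 < t) s hs => ?_)
      refine (h.norm_integrand_le s (le_of_lt ht)).trans ?_
      have hs' : γ' < s.re := hs
      have := h.nonneg
      gcongr
  intro s hs
  have hs' : γ < s.re := hs
  set γ' : ℝ := (γ + s.re) / 2 with hγ'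
  have h1 : γ < γ' := by rw [hγ']; linarith
  have h2 : γ' < s.re := by rw [hγ']; linarith
  have hopen : IsOpen {s : ℂ | γ' < s.re} := isOpen_lt continuous_const Complex.continuous_re
  exact ((hU γ' h1).differentiableAt (hopen.mem_nhds h2)).differentiableWithinAt

/-- `𝓛g` is differentiable at every point of the open half-plane `{Re s > γ}`. [cite: Schiff1999, Theorem 3.1] -/
theorem differentiableAt_laplaceC (h : HalfLineExpBound g G γ) {s : ℂ} (hs : γ < s.re) :
    DifferentiableAt ℂ (laplaceC g) s :=
  h.differentiableOn_laplaceC.differentiableAt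
    ((isOpen_lt continuous_const Complex.continuous_re).mem_nhds hs)

/-- `𝓛g` is continuous on `{Re s > γ}`; in particular along every vertical line there. [cite: Schiff1999, Theorem 3.1] -/
theorem continuous_laplaceC_vertical (h : HalfLineExpBound g G γ) {u : ℝ} (hu : γ < u) :
    Continuous fun y : ℝ => laplaceC g (u + y * I) := by
  have hc : ContinuousOn (laplaceC g) {s : ℂ | γ < s.re} := h.differentiableOn_laplaceC.continuousOn
  refine hc.comp_continuous (by fun_prop) fun y => ?_
  show γ < ((u : ℂ) + (y : ℂ) * I).re
  simpa using hu

end HalfLineExpBound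

/-! ### Linearity and locality -/

/-- `𝓛` only sees `g` on `(0,∞)`. [cite: Schiff1999, §1.1 eq. (1.1)] -/
theorem laplaceC_congr {g₁ g₂ : ℝ → ℂ} (hg : ∀ t : ℝ, 0 < t → g₁ t = g₂ t) (s : ℂ) :
    laplaceC g₁ s = laplaceC g₂ s :=
  setIntegral_congr_fun measurableSet_Ioi fun t ht => by simp only [hg t ht]

/-- Additivity of `𝓛` for integrable integrands (linearity). [cite: Schiff1999, §1.6 (1.11)] -/
theorem laplaceC_add {g₁ g₂ : ℝ → ℂ} {s : ℂ}
    (h₁ : IntegrableOn (fun t : ℝ => cexp (-(s * t)) * g₁ t) (Ioi 0))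
    (h₂ : IntegrableOn (fun t : ℝ => cexp (-(s * t)) * g₂ t) (Ioi 0)) :
    laplaceC (fun t => g₁ t + g₂ t) s = laplaceC g₁ s + laplaceC g₂ s := by
  simp only [laplaceC, mul_add]
  exact integral_add h₁ h₂

/-- Subtractivity of `𝓛` for integrable integrands (linearity). [cite: Schiff1999, §1.6 (1.11)] -/
theorem laplaceC_sub {g₁ g₂ : ℝ → ℂ} {s : ℂ}
    (h₁ : IntegrableOn (fun t : ℝ => cexp (-(s * t)) * g₁ t) (Ioi 0))
    (h₂ : IntegrableOn (fun t : ℝ => cexp (-(s * t)) * g₂ t) (Ioi 0)) :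
    laplaceC (fun t => g₁ t - g₂ t) s = laplaceC g₁ s - laplaceC g₂ s := by
  simp only [laplaceC, mul_sub]
  exact integral_sub h₁ h₂

/-- Homogeneity of `𝓛` (linearity). [cite: Schiff1999, §1.6 (1.11)] -/
theorem laplaceC_const_mul (g : ℝ → ℂ) (c s : ℂ) :
    laplaceC (fun t => c * g t) s = c * laplaceC g s := by
  simp only [laplaceC]
  rw [← integral_const_mul]
  congr 1
  ext t
  ring

/-- The norm of `𝓛g(s)` along a vertical line is controlled by the integral of the norm of the integrand,
which does not depend on `Im s`: `‖𝓛g(u + iy)‖ ≤ ∫_{(0,∞)} e^{−ut}‖g t‖ dt`. [cite: Schiff1999, Theorem 1.11 (proof)] -/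
theorem norm_laplaceC_le_integral_norm (g : ℝ → ℂ) (s : ℂ) :
    ‖laplaceC g s‖ ≤ ∫ t in Ioi (0 : ℝ), Real.exp (-(s.re * t)) * ‖g t‖ := by
  refine (norm_integral_le_integral_norm _).trans (le_of_eq ?_)
  congr 1
  ext t
  rw [norm_mul, norm_cexp_neg_mul_ofReal']

/-! ### One integration by parts -/

namespace HalfLineExpBound

variable {k k' : ℝ → ℂ} {K K' μ : ℝ}

/-- **Integration by parts on the half-line.** If `k, k'` are continuous, `k' = dk/dt` on `(0,∞)`, and both are
`O(e^{−μt})`, then `s·𝓛k(s) = k(0) + 𝓛k'(s)` for `Re s > −μ` (the Derivative Theorem). [cite: Schiff1999, Theorem 2.7] -/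
theorem mul_laplaceC_eq (hk : HalfLineExpBound k K (-μ)) (hk' : HalfLineExpBound k' K' (-μ))
    (hd : ∀ t : ℝ, 0 < t → HasDerivAt k (k' t) t) {s : ℂ} (hs : -μ < s.re) :
    s * laplaceC k s = k 0 + laplaceC k' s := by
  -- `f(t) = e^{−st}k(t)`, `f' = −s e^{−st} k + e^{−st} k'`
  set f : ℝ → ℂ := fun t => cexp (-(s * t)) * k t with hf
  set f' : ℝ → ℂ := fun t => -s * (cexp (-(s * t)) * k t) + cexp (-(s * t)) * k' t with hf'
  have hcont : ContinuousWithinAt f (Ici 0) 0 :=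
    ((continuous_cexp_neg_mul s).mul hk.continuous).continuousWithinAt
  have hderiv : ∀ t ∈ Ioi (0 : ℝ), HasDerivAt f (f' t) t := by
    intro t ht
    have h := (hasDerivAt_cexp_neg_mul s t).mul (hd t ht)
    have h' : HasDerivAt f (-s * cexp (-(s * t)) * k t + cexp (-(s * t)) * k' t) t := h
    exact h'.congr_deriv (by simp only [hf']; ring)
  have hint1 : IntegrableOn (fun t : ℝ => cexp (-(s * t)) * k t) (Ioi 0) := hk.integrableOn hs
  have hint2 : IntegrableOn (fun t : ℝ => cexp (-(s * t)) * k' t) (Ioi 0) := hk'.integrableOn hs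
  have hf'int : IntegrableOn f' (Ioi 0) := (hint1.const_mul (-s)).add hint2
  have hlim : Tendsto f atTop (𝓝 0) := by
    rw [tendsto_zero_iff_norm_tendsto_zero]
    have hexp : Tendsto (fun t : ℝ => K * Real.exp ((-μ - s.re) * t)) atTop (𝓝 0) := by
      have : Tendsto (fun t : ℝ => Real.exp ((-μ - s.re) * t)) atTop (𝓝 0) := by
        refine Real.tendsto_exp_atBot.comp ?_
        exact Filter.Tendsto.const_mul_atTop_of_neg (by linarith) tendsto_id
      simpa using this.const_mul K
    refine squeeze_zero_norm' ?_ hexp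
    filter_upwards [Ioi_mem_atTop (0 : ℝ)] with t ht
    rw [norm_norm]
    exact hk.norm_integrand_le s (le_of_lt ht)
  have key := integral_Ioi_of_hasDerivAt_of_tendsto hcont hderiv hf'int hlim
  have hsplit : ∫ t in Ioi (0 : ℝ), f' t = -s * laplaceC k s + laplaceC k' s := by
    rw [hf', integral_add (hint1.const_mul (-s)) hint2, MeasureTheory.integral_const_mul]
    rfl
  rw [hsplit, hf] at key
  simp only [Complex.ofReal_zero, mul_zero, neg_zero, Complex.exp_zero, one_mul, zero_sub] at key
  linear_combination -key

/-- **Uniform decay on a closed half-plane from one integration by parts.** Under the hypotheses of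
`mul_laplaceC_eq`, for `−μ < −β ≤ Re s` and `s ≠ 0`: `‖𝓛k(s)‖ ≤ (‖k 0‖ + K'/(μ − β))/‖s‖` (the Derivative Theorem read
as a decay estimate, cf. the growth condition (4.8) of the complex inversion formula). [cite: Schiff1999, Theorem 2.7 / §4.1 (4.8)] -/
theorem norm_laplaceC_le_div_norm (hk : HalfLineExpBound k K (-μ)) (hk' : HalfLineExpBound k' K' (-μ))
    (hd : ∀ t : ℝ, 0 < t → HasDerivAt k (k' t) t) {β : ℝ} (hβμ : β < μ) {s : ℂ} (hs : -β ≤ s.re)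
    (hs0 : s ≠ 0) :
    ‖laplaceC k s‖ ≤ (‖k 0‖ + K' / (μ - β)) / ‖s‖ := by
  have hs' : -μ < s.re := by linarith
  have hid := mul_laplaceC_eq hk hk' hd hs'
  have h1 : ‖laplaceC k' s‖ ≤ K' / (μ - β) := by
    refine (hk'.norm_laplaceC_le hs').trans ?_
    rw [sub_neg_eq_add]
    have hK' := hk'.nonneg
    have h2 : 0 < μ - β := by linarith
    have h3 : μ - β ≤ s.re + μ := by linarith
    exact div_le_div_of_nonneg_left hK' h2 h3
  have hspos : 0 < ‖s‖ := norm_pos_iff.2 hs0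
  rw [le_div_iff₀ hspos, mul_comm, ← norm_mul, hid]
  exact (norm_add_le _ _).trans (by linarith)

end HalfLineExpBound

end Literature.Analysis.Complex
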